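import Literature.Analysis.FunctionSpaces.BoxingInequality

/-!
# Maz'ya's trace inequality, piece P3: the boxing inequality for superlevel sets, for
# `liminf`-type perimeter surrogates

(namespace `Literature.Analysis.FunctionSpaces`) [topic Analysis/FunctionSpaces]

The BV-free interface of record for the re-proof of Maz'ya, *Sobolev Spaces* (1985), §1.4.2 Thm 2
(cell pub/ns-inputs, kits/A2.md) measures the boundary of a superlevel set `{t < u}` of a smooth `u`
by a surrogate of the form

  `Per U = liminf_k ∫⁻_U f_k`,   `f_k = η_k'(u - t) · ‖∇u‖`

(`levelPerimeter u t U` of `MazyaTraceLevelSet.lean`, `η_k = levelStep k`).  For ANY sequence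
`f : ℕ → ℝ³ → [0,∞]` such a functional is finitely superadditive over disjoint balls
(`liminf Σ ≥ Σ liminf` and additivity of `∫⁻` over disjoint measurable sets), so the abstract boxing
inequality `setLIntegral_le_of_ballGrowthTwo_of_relIsoperimetric` (BoxingInequality.lean) applies as
soon as the weak relative isoperimetric inequality in balls (piece P2) is available for it:

* `setLIntegral_le_liminf_of_relIsoperimetric` — bounded open `E`;
* `setLIntegral_superlevel_le_liminf_of_relIsoperimetric` — `E = {t < u}`, `u` continuous with compact
  support, `t > 0` (then `E` is open and bounded): `∫_{t<u} g ≤ 8 C₂ K · liminf_k ∫⁻ f_k`.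

This is the level-set estimate `μ(ℒ_t) ≤ sup[μ(g)/s(∂g)] · s(∂ℒ_t)` in Maz'ya's proof of §1.4.2
Theorem 1/Theorem 2 (via Gustin's covering theorem §1.2.1 Thm 2), with `s(∂ℒ_t)` replaced by the
surrogate.  Specialising `f_k` to `η_k'(u - t)‖∇u‖` is definitional unfolding of `levelPerimeter` and is
done where that definition lives.  No NS statement is involved; no co-area formula, no sets of finite
perimeter, no Hausdorff measure.
-/

noncomputable section

namespace Literature.Analysis.FunctionSpaces

open MeasureTheory Set Metric Filter Topology
open scoped ENNReal NNReal

/-! ### `liminf` is superadditive (ℝ≥0∞, sequences) -/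

/-- `liminf a + liminf b ≤ liminf (a + b)` for sequences in `ℝ≥0∞`. [folklore] -/
private theorem liminf_add_liminf_le_liminf_add (a b : ℕ → ℝ≥0∞) :
    liminf a atTop + liminf b atTop ≤ liminf (fun k => a k + b k) atTop := by
  simp only [liminf_eq_iSup_iInf_of_nat]
  refine ENNReal.iSup_add_iSup_le fun n m => ?_
  refine le_trans ?_ (le_iSup (fun N => ⨅ i ≥ N, (a i + b i)) (max n m))
  refine le_iInf₂ fun i hi => ?_
  exact add_le_add (iInf₂_le i (le_of_max_le_left hi)) (iInf₂_le i (le_of_max_le_right hi))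

/-- `Σ_{i ∈ s} liminf aᵢ ≤ liminf Σ_{i ∈ s} aᵢ` for finitely many sequences in `ℝ≥0∞`. [folklore] -/
private theorem sum_liminf_le_liminf_sum {ι : Type*} (s : Finset ι) (a : ι → ℕ → ℝ≥0∞) :
    ∑ i ∈ s, liminf (a i) atTop ≤ liminf (fun k => ∑ i ∈ s, a i k) atTop := by
  classical
  induction s using Finset.induction_on with
  | empty => simp [liminf_const]
  | insert j s hj ih =>
      simp only [Finset.sum_insert hj]
      exact (add_le_add le_rfl ih).trans (liminf_add_liminf_le_liminf_add _ _)

/-- Finite superadditivity of `U ↦ liminf_k ∫⁻_U f_k` over pairwise disjoint balls. [folklore] -/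
private theorem sum_liminf_setLIntegral_ball_le
    (f : ℕ → EuclideanSpace ℝ (Fin 3) → ℝ≥0∞)
    (F : Finset (EuclideanSpace ℝ (Fin 3))) (ρ : EuclideanSpace ℝ (Fin 3) → ℝ)
    (hF : (F : Set (EuclideanSpace ℝ (Fin 3))).PairwiseDisjoint fun x => ball x (ρ x)) :
    ∑ x ∈ F, liminf (fun k => ∫⁻ y in ball x (ρ x), f k y) atTop ≤
      liminf (fun k => ∫⁻ y in (univ : Set (EuclideanSpace ℝ (Fin 3))), f k y) atTop := by
  refine (sum_liminf_le_liminf_sum F _).trans (liminf_le_liminf (Eventually.of_forall fun k => ?_))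
  rw [← lintegral_biUnion_finset hF fun b _ => measurableSet_ball]
  exact lintegral_mono_set (subset_univ _)

/-! ### P3: the boxing inequality for `liminf`-surrogates -/

/-- **Boxing inequality for a `liminf` perimeter surrogate, bounded open set.**  Let `E ⊆ ℝ³` be open
and bounded, `∫_{B(x,r)} g ≤ K r²` for all balls, `f : ℕ → ℝ³ → [0,∞]` any sequence, and suppose the
weak relative isoperimetric inequality
`min(vol(E ∩ B(x,r)), vol(B(x,r) ∖ E)) ≤ C₂ r · liminf_k ∫⁻_{B(x,r)} f_k` holds at the points of `E`.
Then `∫_E g ≤ 8 C₂ K · liminf_k ∫⁻_{ℝ³} f_k` (Maz'ya's level-set estimate via Gustin's covering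
theorem, with `s(∂E ∩ ·)` replaced by the surrogate).
[cite: Mazja1985, §1.4.2 Theorem 1/Theorem 2, proof: μ(g) ≤ sup μ(g)/s(∂g) · s(∂g) via §1.2.1 Theorem 2] -/
theorem setLIntegral_le_liminf_of_relIsoperimetric {E : Set (EuclideanSpace ℝ (Fin 3))}
    (hEo : IsOpen E) (hEb : Bornology.IsBounded E)
    {g : EuclideanSpace ℝ (Fin 3) → ℝ≥0∞} {K : ℝ≥0} (hg : BallGrowthTwo g K)
    (f : ℕ → EuclideanSpace ℝ (Fin 3) → ℝ≥0∞) {C₂ : ℝ≥0}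
    (hiso : ∀ x ∈ E, ∀ r : ℝ, 0 < r →
      min (volume (E ∩ ball x r)) (volume (ball x r \ E)) ≤
        (C₂ : ℝ≥0∞) * ENNReal.ofReal r * liminf (fun k => ∫⁻ y in ball x r, f k y) atTop) :
    ∫⁻ y in E, g y ≤
      8 * C₂ * K * liminf (fun k => ∫⁻ y in (univ : Set (EuclideanSpace ℝ (Fin 3))), f k y) atTop := by
  have h := setLIntegral_le_of_ballGrowthTwo_of_relIsoperimetric hEo hEb hg
    (fun U => liminf (fun k => ∫⁻ y in U, f k y) atTop) one_pos (C₂ := C₂)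
    (fun F ρ _ hF => sum_liminf_setLIntegral_ball_le f F ρ hF)
    (fun x hx r hr => by simpa only [one_mul] using hiso x hx r hr)
  simpa only [one_pow, mul_one, ENNReal.ofReal_ofNat] using h

/-- **Boxing inequality for superlevel sets (piece P3 of Maz'ya §1.4.2 Thm 2, BV-free form).**  Let `u`
be continuous with compact support, `t > 0`, `∫_{B(x,r)} g ≤ K r²` for all balls, `f : ℕ → ℝ³ → [0,∞]`
any sequence (in the application `f_k = η_k'(u-t)‖∇u‖`, so that `liminf_k ∫⁻_U f_k = levelPerimeter u t U`),
and suppose `min(vol({t<u} ∩ B(x,r)), vol(B(x,r) ∖ {t<u})) ≤ C₂ r · liminf_k ∫⁻_{B(x,r)} f_k` at the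
points of `{t < u}`.  Then `∫_{t<u} g ≤ 8 C₂ K · liminf_k ∫⁻_{ℝ³} f_k`.  (The superlevel set is open, and
bounded because it lies in the support of `u` as `t > 0`.)
[cite: Mazja1985, §1.4.2 Theorem 1/Theorem 2, proof: the level-set estimate μ(ℒ_t) ≤ sup μ(g)/s(∂g) · s(∂ℒ_t)] -/
theorem setLIntegral_superlevel_le_liminf_of_relIsoperimetric {u : EuclideanSpace ℝ (Fin 3) → ℝ}
    (hu : Continuous u) (hsupp : HasCompactSupport u) {t : ℝ} (ht : 0 < t)
    {g : EuclideanSpace ℝ (Fin 3) → ℝ≥0∞} {K : ℝ≥0} (hg : BallGrowthTwo g K)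
    (f : ℕ → EuclideanSpace ℝ (Fin 3) → ℝ≥0∞) {C₂ : ℝ≥0}
    (hiso : ∀ x ∈ {y | t < u y}, ∀ r : ℝ, 0 < r →
      min (volume ({y | t < u y} ∩ ball x r)) (volume (ball x r \ {y | t < u y})) ≤
        (C₂ : ℝ≥0∞) * ENNReal.ofReal r * liminf (fun k => ∫⁻ y in ball x r, f k y) atTop) :
    ∫⁻ y in {y | t < u y}, g y ≤
      8 * C₂ * K * liminf (fun k => ∫⁻ y in (univ : Set (EuclideanSpace ℝ (Fin 3))), f k y) atTop := by
  have hEo : IsOpen {y | t < u y} := isOpen_lt continuous_const hu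
  have hEb : Bornology.IsBounded {y | t < u y} := by
    refine hsupp.isCompact.isBounded.subset fun y hy => subset_tsupport u ?_
    rw [Function.mem_support]
    exact (ht.trans hy).ne'
  exact setLIntegral_le_liminf_of_relIsoperimetric hEo hEb hg f hiso

end Literature.Analysis.FunctionSpaces

end
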